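import Literature.Analysis.Matrix.SuffixSumVolume
import Mathlib.MeasureTheory.Measure.Haar.Unique
import Mathlib.MeasureTheory.Measure.Prod
import HarnessLib

/-!
# Point times from gaps and an anchor: a volume-preserving change of variables on `ℝ^{m+1}`

Analysis/Matrix support file, sequel of `SuffixSumVolume`. In the Osterwalder–Schrader regularisation
estimates (Comm. Math. Phys. 42 (1975), Ch. VI.1) a cluster of `m + 1` points is parametrised by its
`m` consecutive gaps `g` and the time `t` of its last point: the point times are

  `gapAnchor (t, g) = (t - ∑_{a ≥ J} gₐ)_{J < m}, t`   (a `Fin.snoc`).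

This file proves that `(t, g) ↦ gapAnchor (t, g)` carries Lebesgue measure on `ℝ × ℝᵐ` to Lebesgue
measure on `ℝ^{m+1}`, in the form of the **change of variables**

  `∫_{ℝ×ℝᵐ} F(gapAnchor z) dz = ∫_{ℝ^{m+1}} F(a) da`   (`integral_gapAnchor`, for every `F`),

by composing the measure-preserving shear `(t, g) ↦ (t, t·1 - S g)` (`shearEquiv`, from
`measurePreserving_suffixSum`, translation and reflection invariance, and
`MeasurePreserving.skew_product`) with Mathlib's `MeasurableEquiv.piFinSuccAbove` at the last
coordinate.
-/

noncomputable section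

open MeasureTheory

namespace Literature.Analysis.Matrix

variable (m : ℕ)

/-- **Point times from gaps and anchor**: `gapAnchor (t, g) = Fin.snoc (J ↦ t - (S g)_J) t`. [folklore] -/
def gapAnchor (z : ℝ × (Fin m → ℝ)) : Fin (m + 1) → ℝ := Fin.snoc (fun J => z.1 - suffixSum m z.2 J) z.1

/-- The last point time is the anchor. [folklore] -/
@[simp] theorem gapAnchor_last (z : ℝ × (Fin m → ℝ)) : gapAnchor m z (Fin.last m) = z.1 := by
  simp [gapAnchor]

/-- The other point times. [folklore] -/
@[simp] theorem gapAnchor_castSucc (z : ℝ × (Fin m → ℝ)) (J : Fin m) :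
    gapAnchor m z J.castSucc = z.1 - suffixSum m z.2 J := by
  simp [gapAnchor]

/-- The **shear** `(t, g) ↦ (t, t·1 - S g)` as a measurable equivalence of `ℝ × ℝᵐ`. [folklore] -/
def shearEquiv : (ℝ × (Fin m → ℝ)) ≃ᵐ (ℝ × (Fin m → ℝ)) where
  toFun z := (z.1, fun J => z.1 - suffixSum m z.2 J)
  invFun z := (z.1, (suffixSumEquiv m).symm fun J => z.1 - z.2 J)
  left_inv z := by
    rcases z with ⟨t, g⟩
    simp only [sub_sub_cancel]
    congr 1
    have : (fun J => suffixSum m g J) = suffixSumEquiv m g := rfl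
    rw [this, ContinuousLinearEquiv.symm_apply_apply]
  right_inv z := by
    rcases z with ⟨t, v⟩
    simp only
    congr 1
    funext J
    have : suffixSum m ((suffixSumEquiv m).symm fun J => t - v J) J = (suffixSumEquiv m ((suffixSumEquiv m).symm fun J => t - v J)) J := rfl
    rw [this, ContinuousLinearEquiv.apply_symm_apply]
    ring
  measurable_toFun := by
    refine measurable_fst.prodMk (measurable_pi_iff.2 fun J => ?_)
    exact measurable_fst.sub (((suffixSum m).continuous_of_finiteDimensional.measurable.comp measurable_snd) |>
      fun h => (measurable_pi_apply J).comp h)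
  measurable_invFun := by
    refine measurable_fst.prodMk ?_
    refine (suffixSumEquiv m).symm.continuous.measurable.comp (measurable_pi_iff.2 fun J => ?_)
    exact measurable_fst.sub ((measurable_pi_apply J).comp measurable_snd)

/-- Values of the shear. [folklore] -/
@[simp] theorem shearEquiv_apply (z : ℝ × (Fin m → ℝ)) :
    shearEquiv m z = (z.1, fun J => z.1 - suffixSum m z.2 J) := rfl

/-- For fixed anchor, `g ↦ t·1 - S g` preserves Lebesgue measure on `ℝᵐ`. [folklore] -/
theorem map_sub_suffixSum_eq (t : ℝ) :
    Measure.map (fun g : Fin m → ℝ => fun J => t - suffixSum m g J) volume = volume := by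
  have hcomp : (fun g : Fin m → ℝ => fun J => t - suffixSum m g J) =
      (fun v : Fin m → ℝ => (fun _ => t) - v) ∘ (suffixSum m) := by
    funext g; rfl
  have hmeas : Measurable (fun v : Fin m → ℝ => (fun _ => t) - v) := measurable_const.sub measurable_id
  rw [hcomp, ← Measure.map_map hmeas (suffixSum m).continuous_of_finiteDimensional.measurable,
    (measurePreserving_suffixSum m).map_eq]
  exact Measure.map_sub_left_eq_self volume (fun _ => t)

/-- **The shear preserves Lebesgue measure on `ℝ × ℝᵐ`.** [folklore] -/
theorem measurePreserving_shearEquiv :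
    MeasurePreserving (shearEquiv m) ((volume : Measure ℝ).prod (volume : Measure (Fin m → ℝ)))
      ((volume : Measure ℝ).prod (volume : Measure (Fin m → ℝ))) := by
  have h := MeasurePreserving.skew_product (μa := (volume : Measure ℝ)) (μc := (volume : Measure (Fin m → ℝ)))
    (MeasurePreserving.id volume) (g := fun (t : ℝ) (g : Fin m → ℝ) => fun J => t - suffixSum m g J)
    (by
      refine measurable_pi_iff.2 fun J => ?_
      exact measurable_fst.sub ((measurable_pi_apply J).comp
        ((suffixSum m).continuous_of_finiteDimensional.measurable.comp measurable_snd)))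
    (Filter.Eventually.of_forall fun t => map_sub_suffixSum_eq m t)
  exact h

/-- **Change of variables from (anchor, gaps) to point times**:
`∫_{ℝ×ℝᵐ} F(gapAnchor z) dz = ∫_{ℝ^{m+1}} F(a) da` for every `F`. [folklore] -/
theorem integral_gapAnchor {E : Type*} [NormedAddCommGroup E] [NormedSpace ℝ E] (F : (Fin (m + 1) → ℝ) → E) :
    (∫ z : ℝ × (Fin m → ℝ), F (gapAnchor m z)) = ∫ a : Fin (m + 1) → ℝ, F a := by
  -- the shear
  have h1 : (∫ z : ℝ × (Fin m → ℝ), F (gapAnchor m z)) =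
      ∫ z : ℝ × (Fin m → ℝ), F (Fin.snoc z.2 z.1) := by
    have h := (measurePreserving_shearEquiv m).integral_comp' (f := shearEquiv m) (fun z => F (Fin.snoc z.2 z.1))
    exact h
  -- the last coordinate
  have h2 : (∫ a : Fin (m + 1) → ℝ, F a) = ∫ z : ℝ × (Fin m → ℝ), F (Fin.snoc z.2 z.1) := by
    set e := MeasurableEquiv.piFinSuccAbove (fun _ : Fin (m + 1) => ℝ) (Fin.last m) with he
    have hmp : MeasurePreserving e (volume : Measure (Fin (m + 1) → ℝ))
        ((volume : Measure ℝ).prod (volume : Measure (Fin m → ℝ))) := by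
      have h := measurePreserving_piFinSuccAbove (fun _ : Fin (m + 1) => (volume : Measure ℝ)) (Fin.last m)
      rwa [← volume_pi, ← volume_pi] at h
    rw [← hmp.symm.integral_comp' (f := e.symm) F]
    refine integral_congr_ae (Filter.Eventually.of_forall fun z => ?_)
    change F (Fin.insertNth (Fin.last m) z.1 z.2) = F (Fin.snoc z.2 z.1)
    rw [Fin.insertNth_last']
  rw [h1, h2]

end Literature.Analysis.Matrix
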